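import Literature.NumberTheory.EllipticCurves.ModularCurveManinSemistableKernelProofs
import Literature.NumberTheory.EllipticCurves.ModularCurveManinConstantProofs
import Literature.NumberTheory.EllipticCurves.AnalyticIsogenyDescentProofs
import Literature.NumberTheory.EllipticCurves.PeriodLatticeRationalityUnconditionalProofs
import Literature.NumberTheory.EllipticCurves.ComplexMultiplicationLFunctionIsogenyHoldsProofs
import Literature.NumberTheory.EllipticCurves.EichlerShimuraConstructionLatticeProofs
import HarnessLib

/-!
# `abs_maninConstant_eq_one_of_isSemistable` is exactly Česnavičius's theorem in lattice form:
# the Eichler–Shimura input `hES` discharged for parametrised curves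

Topic `NumberTheory/EllipticCurves`; a proofs-only companion (theorems only: no definitions, no
named facts) of `ModularCurveManinSemistableProofs.lean` and
`ModularCurveManinSemistableKernelProofs.lean`. Those files reduced the named fact
`ModularParametrizationData.abs_maninConstant_eq_one_of_isSemistable` (`ModularCurve.lean`;
Česnavičius 2018, Thm. 1.2) to two inputs: `hES` — the Eichler–Shimura construction *with its
period lattice* (a `ℚ`-model `W₀` of the strong Weil curve with `aₙ(W₀) = aₙ(f)` and a
Néron-type period pair spanning exactly `Λ_f`; Knapp 1993, Thm. 11.74 (c)–(e), Thm. 12.8,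
Prop. 12.9 (a)) — and `hCes`, Česnavičius's theorem in lattice form, and showed that the
universal closure of the fact is *equivalent* to `hCes` granted `hES`.

Here `hES` is **proved at every newform that parametrises some elliptic curve over `ℚ`** — in
particular at the newform `D.f` of any datum `D`, which is all the reduction uses — so that the
fact becomes equivalent to `hCes` **unconditionally**:

* `isIsogenous_iff_exists_int_mul_mem_lattice` — **`W ~_ℚ W'` iff the Néron lattices are
  commensurable** (`aΛ ⊆ Λ'`, `a ∈ ℤ ∖ {0}`): the tree's discharged fact
  `neronLattice_commensurable_of_isIsogenous_holds` one way, the new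
  `isIsogenous_of_forall_mul_mem_lattice` (`AnalyticIsogenyDescentProofs`) the other
  (Silverman AEC Thm. VI.4.1 (b) / VI.5.3 over `ℚ`);
* `IsNewformOf.of_isIsogenous` — `ℚ`-isogenous elliptic curves have the same newform
  (`WeierstrassCurve.IsIsogenous.LFunction_eq`: Faltings 1983, §5 Kor. 2 / Knapp 1993,
  Thm. 11.67, a theorem of the tree);
* `ModularParametrizationData.exists_latticeEq_model` — **`hES` at `D.f`**: the curve
  `E_f = ℂ/Λ_f` is an elliptic curve over `ℚ` with Néron-type period lattice `Λ_f`
  (`IsNewform0.exists_shortModel_periodLattice`, the tree's unconditional form of Knapp's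
  Thm. 11.74 (d) / Cremona 1997, §2.14), and it is `ℚ`-isogenous to `W` because `cΛ_f ⊆ Λ_E`
  (`isIsogenous_of_forall_mul_mem_lattice`: the analytic isogeny `z ↦ cz` is defined over `ℚ`;
  Silverman AEC Thm. VI.4.1 / VI.5.3 with descent), whence `aₙ(E_f) = aₙ(W) = aₙ(f)` for all `n`
  — Knapp's Thm. 11.74 (e) for `E_f`, obtained here without the Eichler–Shimura congruence
  relation, from the modularity of the given `W`;
* `ModularParametrizationData.exists_optimalDatum'` — hence an **optimal** datum `D₀`
  (`c₀ = 1`, `Λ_{E₀} = Λ_f`) with the same newform exists, unconditionally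
  (uniformisation `IsNeronLatticeOf.exists_uniformize_holds` and the degree of the
  Eichler–Shimura map `exists_modularDegree_holds` being theorems of the tree);
* `ModularParametrizationData.abs_maninConstant_eq_one_of_isSemistable_of_cesnavicius` — **the
  fact from `hCes` alone**, and
  `ModularParametrizationData.forall_abs_maninConstant_eq_one_of_isSemistable_iff_cesnavicius` —
  **the universal closure of the fact is equivalent to `hCes`**, with no hypothesis: the
  vendored statement is a faithful transcription of Česnavičius's theorem for `Γ₀(N)`-optimal
  parametrisations of semistable curves, neither weaker nor stronger, and its only open content
  is Česnavičius's theorem proper (Néron models of `J₀(N)` and `E` over `ℤ_(p)`, the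
  Deligne–Rapoport model of `X₀(N)`, Grothendieck duality and multiplicity one; Česnavičius 2018,
  §2), which is not attempted.

Nothing is discharged (the fact needs `hCes`) and no statement of the tree is changed.

## References

* K. Česnavičius, *The Manin constant in the semistable case*, Compositio Math. 154 (2018),
  1889–1920: Thm. 1.2 and §2. [Cesnavicius2018]
* A. W. Knapp, *Elliptic Curves*, Math. Notes 40, Princeton 1993: Thm. 11.67 (PDF p. 281),
  Thm. 11.74 with Remarks (PDF p. 287), Thm. 12.8 (PDF p. 301), Prop. 12.9 (a) and PDF p. 302.
  [Knapp1993]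
* J. E. Cremona, *Algorithms for modular elliptic curves*, 2nd ed., CUP 1997: §2.14
  (pp. 33–34). [CremonaAlgorithms1997]
* J. H. Silverman, *The Arithmetic of Elliptic Curves*, 2nd ed., GTM 106 (2009): Thm. VI.4.1,
  Thm. VI.5.3. [SilvermanAEC2009]
* G. Faltings, *Endlichkeitssätze für abelsche Varietäten über Zahlkörpern*, Invent. Math. 73
  (1983): §5, Korollar 2. [Faltings1983Endlichkeit]
-/

noncomputable section

open scoped MatrixGroups ModularForm

open CongruenceSubgroup UpperHalfPlane

namespace Literature.NumberTheory.EllipticCurves.ModularForms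

/-! ### Isogenous curves have the same newform -/

/-- **`ℚ`-isogenous elliptic curves have the same newform**: if `f` is the newform of `W`
(`aₙ(f) = aₙ(W)` for all `n`) and `W' → W` is an isogeny over `ℚ`, then `f` is the newform of
`W'`, since `L(W, s) = L(W', s)` coefficientwise (`WeierstrassCurve.IsIsogenous.LFunction_eq`;
Faltings 1983, §5 Kor. 2; Knapp 1993, Thm. 11.67). [cite: Knapp1993, Thm. 11.67 (PDF p. 281)] -/
theorem IsNewformOf.of_isIsogenous {W W' : WeierstrassCurve ℚ} [W.IsElliptic] [W'.IsElliptic]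
    {N : ℕ} [NeZero N] {f : CuspForm (Gamma0 N) 2} (h : IsNewformOf W f)
    (hiso : WeierstrassCurve.IsIsogenous W' W) : IsNewformOf W' f :=
  ⟨h.1, fun n ↦ by rw [h.2 n, hiso.LFunction_eq]⟩

namespace ModularParametrizationData

variable {W : WeierstrassCurve ℚ} {N : ℕ} [NeZero N] (D : ModularParametrizationData W N)

/-! ### `hES` at the newform of a datum -/

/-- **The Eichler–Shimura construction with its period lattice, at the newform of a datum.** Let
`D` be a modular parametrisation datum of an elliptic curve `W/ℚ` with newform `f`
(`aₙ(f) = aₙ(W)`) and Manin constant `c`, `cΛ_f ⊆ Λ_E`. Then there is an elliptic curve `W₀/ℚ`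
with `aₙ(W₀) = aₙ(f)` for all `n` and a Néron-type period pair `L₀` of `W₀` spanning exactly
`Λ_f`: take `W₀ = E_f : y² = x³ + a₄x + a₆`, the `ℚ`-model of `ℂ/Λ_f`
(`IsNewform0.exists_shortModel_periodLattice`: `g₂(Λ_f), g₃(Λ_f) ∈ ℚ`, Knapp 1993, Thm. 11.74 (d),
Cremona 1997, §2.14, proved in the tree), which is `ℚ`-isogenous to `W` along `z ↦ cz`
(`isIsogenous_of_forall_mul_mem_lattice`, `c ≠ 0` by `maninConstant_ne_zero_holds`), so that
`aₙ(E_f) = aₙ(W) = aₙ(f)` (`IsNewformOf.of_isIsogenous`). This is the hypothesis `hES` of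
`abs_maninConstant_eq_one_of_isSemistable_of` at `(N, f)` — Knapp's Thm. 11.74 (c)–(e) for the
strong Weil curve of `f` — obtained from the modularity of `W` instead of the Eichler–Shimura
congruence relation. [cite: Knapp1993, Thm. 11.74 (d), (e) with Remarks (PDF p. 287)] -/
theorem exists_latticeEq_model [W.IsElliptic] :
    ∃ (W₀ : WeierstrassCurve ℚ) (_ : W₀.IsElliptic), IsNewformOf W₀ D.f ∧
      ∃ L₀ : PeriodPair, IsNeronLatticeOf (W₀.baseChange ℂ) L₀ ∧
        (L₀.lattice : Set ℂ) = periodLattice D.f := by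
  have hf : IsNewform0 D.f := D.isNewformOf.1
  have hQ : coeffField D.f = ⊥ :=
    coeffField_eq_bot_of_forall_exists_intCast fun n ↦ ⟨W.LFunction n, D.isNewformOf.2 n⟩
  obtain ⟨Lf, a₄, a₆, hLf, hE, hNer⟩ := hf.exists_shortModel_periodLattice hQ
  haveI := hE
  have hmem : ∀ z, z ∈ Lf.lattice ↔ z ∈ periodLattice D.f := fun z ↦ by
    rw [← hLf]
    rfl
  -- `c Λ_f ⊆ Λ_E` with `c ≠ 0`, so `E_f` and `W` are isogenous over `ℚ`
  have hc : (D.c : ℚ) ≠ 0 := by exact_mod_cast D.maninConstant_ne_zero_holds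
  have hle : ∀ z ∈ Lf.lattice, ((D.c : ℚ) : ℂ) * z ∈ D.L.lattice := fun z hz ↦ by
    rw [Rat.cast_intCast]
    exact D.smul_periodLattice_le z ((hmem z).mp hz)
  have hiso := isIsogenous_of_forall_mul_mem_lattice hNer.1 hNer.2 D.isNeronLattice.1
    D.isNeronLattice.2 hc hle
  exact ⟨_, hE, D.isNewformOf.of_isIsogenous hiso, Lf, hNer, Set.ext fun z ↦ hmem z⟩

/-! ### An optimal datum exists, unconditionally -/

/-- **Existence of an optimal datum, unconditionally.** For every modular parametrisation datum
`D` of an elliptic curve `W/ℚ` there is an **optimal** datum `D₀` — `c₀ = 1`, `Λ_{E₀} = Λ_f`,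
i.e. `φ_{D₀}` is the parametrisation `X₀(N) → ℂ/Λ_f = E_f` of the strong Weil curve — of an
elliptic curve `W₀/ℚ` with the same newform: `exists_optimalDatum` with its input `hES`
supplied, at `D.f`, by `exists_latticeEq_model`; the uniformisation of `W₀` and the degree of
`Γ₀(N)τ ↦ 2πi ∫_{i∞}^τ f (mod Λ_f)` are the tree's `IsNeronLatticeOf.exists_uniformize_holds`
and `exists_modularDegree_holds`. (Knapp 1993, Thm. 11.74 (c), (d) with Prop. 12.9 (a) and
p. 302: the construction "uses the full image of cycles of `X₀(N)` as the set of periods".)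
[cite: Knapp1993, Thm. 11.74 (c)(d) with Prop. 12.9(a) and p. 302] -/
theorem exists_optimalDatum' [W.IsElliptic] :
    ∃ (W₀ : WeierstrassCurve ℚ) (_ : W₀.IsElliptic) (D₀ : ModularParametrizationData W₀ N),
      D₀.f = D.f ∧ ∀ z ∈ D₀.L.lattice, ∃ w ∈ periodLattice D₀.f, z = D₀.c * w := by
  obtain ⟨W₀, hW₀, hf₀, L₀, hL₀, hΛ⟩ := D.exists_latticeEq_model
  haveI := hW₀
  haveI : (W₀.baseChange ℂ).IsElliptic := by rw [WeierstrassCurve.baseChange]; infer_instance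
  obtain ⟨u, hker, hsurj, hspec⟩ := IsNeronLatticeOf.exists_uniformize_holds hL₀
  have hmem : ∀ z : ℂ, z ∈ L₀.lattice ↔ z ∈ periodLattice D.f := fun z ↦ by
    rw [← SetLike.mem_coe, hΛ, SetLike.mem_coe]
  have hc : ∀ z ∈ periodLattice D.f, ((1 : ℤ) : ℂ) * z ∈ L₀.lattice := fun z hz ↦ by
    rw [Int.cast_one, one_mul, hmem]
    exact hz
  obtain ⟨d, hd, hfin⟩ := exists_modularDegree_holds D.isNewformOf.1.ne_zero
    (L := L₀) (c := ((1 : ℤ) : ℂ)) (Int.cast_ne_zero.mpr one_ne_zero) hc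
  -- transport the exceptional set along `ℂ/Λ₀ ≃ E₀(ℂ)`
  have hker' : L₀.lattice.toAddSubgroup = u.ker :=
    SetLike.coe_injective (by rw [Submodule.coe_toAddSubgroup, hker])
  let e : ℂ ⧸ L₀.lattice.toAddSubgroup ≃+ (W₀.baseChange ℂ).toAffine.Point :=
    QuotientAddGroup.liftEquiv L₀.lattice.toAddSubgroup hsurj hker'
  have he : ∀ x : ℂ, e.toEquiv (x : ℂ ⧸ L₀.lattice.toAddSubgroup) = u x := fun _ ↦ rfl
  have key := (finite_setOf_card_fiberOrbits_ne_iff e.toEquiv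
    (fun τ : ℍ ↦ ((((1 : ℤ) : ℂ) * eichlerIntegral D.f τ : ℂ) : ℂ ⧸ L₀.lattice.toAddSubgroup))
    d).mpr hfin
  simp only [he] at key
  refine ⟨W₀, hW₀,
    { f := D.f
      isNewformOf := hf₀
      L := L₀
      isNeronLattice := hL₀
      uniformize := u
      ker_uniformize := hker
      uniformize_surjective := hsurj
      uniformize_spec := hspec
      c := 1
      smul_periodLattice_le := hc
      deg := d
      deg_pos := hd
      deg_spec := key }, rfl, fun z hz ↦ ⟨z, (hmem z).mp hz, ?_⟩⟩
  simp

/-! ### The fact from Česnavičius's theorem alone -/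

/-- **`abs_maninConstant_eq_one_of_isSemistable` from Česnavičius's theorem in lattice form,
with no other input.** Assume (`hCes`) Česnavičius's theorem in lattice form: for a globally
minimal model `W'/ℚ` (so `ω_{W'}` is a Néron differential, Agashe–Ribet–Stein 2006, §2) of a
semistable elliptic curve and a datum `D'` with `c Λ_f = Λ_{E'}` — `φ_{D'}` is the optimal
parametrisation `X₀(N') → E_f` followed by the `ℚ`-isomorphism `z ↦ cz`, so `c = ±c_π` for the
new elliptic optimal quotient `π : J₀(N') ↠ E'` — one has `|c| = 1` (Česnavičius 2018, Thm. 1.2: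
`v_p(c_π) = 0` for `p² ∤ N'`, and `N' = N_{E'}` is squarefree; `c_π ∈ ℤ` by Edixhoven 1991,
Prop. 2). Then the vendored fact holds for every datum `D`: an optimal datum `D₀` with the same
newform exists (`exists_optimalDatum'`, unconditional), the hypothesis `deg φ_D ≤ deg φ_{D₀}` of
the fact makes `D` optimal (`latticeEq_of_modularDegree_le`), and `hCes` applies to `D` itself.
The trust base of this reduction is `hCes` alone. [cite: Cesnavicius2018, Thm. 1.2] -/
theorem abs_maninConstant_eq_one_of_isSemistable_of_cesnavicius
    (hCes : ∀ (W' : WeierstrassCurve ℚ) [W'.IsElliptic] [W'.IsGloballyMinimal] {N' : ℕ} [NeZero N']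
      (D' : ModularParametrizationData W' N'), W'.IsSemistable ℤ →
      (∀ z ∈ D'.L.lattice, ∃ w ∈ periodLattice D'.f, z = D'.c * w) → |D'.maninConstant| = 1) :
    D.abs_maninConstant_eq_one_of_isSemistable := by
  intro _ _ hss hmin
  obtain ⟨W₀, hW₀, D₀, hf₀, h₀⟩ := D.exists_optimalDatum'
  haveI := hW₀
  exact hCes W D hss (D.latticeEq_of_modularDegree_le D₀ hf₀ h₀ (hmin W₀ D₀ hf₀))

/-- **The exact open content, unconditionally.** The universal closure of the vendored fact
`abs_maninConstant_eq_one_of_isSemistable` (the fact for *every* datum, i.e. what a discharge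
`_holds` proves) is **equivalent** to Česnavičius's theorem in lattice form `hCes` (`|c| = 1`
for every datum with `c Λ_f = Λ_{E'}` of a globally minimal model of a semistable elliptic curve
over `ℚ`; Česnavičius 2018, Thm. 1.2 with Edixhoven 1991, Prop. 2): `⇒` is
`cesnavicius_latticeForm_of_forall_abs_maninConstant_eq_one` (an optimal datum has minimal
degree, Knapp 1993, Prop. 12.9 (a)), `⇐` is
`abs_maninConstant_eq_one_of_isSemistable_of_cesnavicius`. Compared with
`forall_abs_maninConstant_eq_one_of_isSemistable_iff` the Eichler–Shimura hypothesis `hES` is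
gone: the vendored statement is a faithful transcription of the printed theorem for
`Γ₀(N)`-optimal parametrisations of semistable curves, and its open content is exactly
Česnavičius's theorem proper. [cite: Cesnavicius2018, Thm. 1.2] -/
theorem forall_abs_maninConstant_eq_one_of_isSemistable_iff_cesnavicius :
    (∀ {W' : WeierstrassCurve ℚ} {N' : ℕ} [NeZero N'] (D' : ModularParametrizationData W' N'),
      D'.abs_maninConstant_eq_one_of_isSemistable) ↔
    ∀ (W' : WeierstrassCurve ℚ) [W'.IsElliptic] [W'.IsGloballyMinimal] {N' : ℕ} [NeZero N']
      (D' : ModularParametrizationData W' N'), W'.IsSemistable ℤ →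
      (∀ z ∈ D'.L.lattice, ∃ w ∈ periodLattice D'.f, z = D'.c * w) → |D'.maninConstant| = 1 :=
  ⟨fun h W' _ _ _ _ D' hss hlat ↦
      cesnavicius_latticeForm_of_forall_abs_maninConstant_eq_one h W' D' hss hlat,
    fun hCes _ _ _ D' ↦ D'.abs_maninConstant_eq_one_of_isSemistable_of_cesnavicius hCes⟩

end ModularParametrizationData

/-! ### Isogeny over `ℚ` is commensurability of the Néron lattices -/

/-- **Two elliptic curves over `ℚ` are `ℚ`-isogenous iff their period lattices are
commensurable** (Silverman, *AEC*, Thm. VI.4.1 (b) / VI.5.3 — `Hom(E₁, E₂) ≅ {α : αΛ₁ ⊆ Λ₂}`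
over `ℂ` — together with the descent to `ℚ`: `ψ^*ω' = αω` forces `α ∈ ℚ` for an isogeny over
`ℚ`, and conversely the analytic isogeny `z ↦ a z`, `a ∈ ℤ ∖ {0}`, is defined over `ℚ`). For
Néron-type period pairs `L, L'` of `W, W'` (`IsNeronLatticeOf`: `g₂ = c₄/12`, `g₃ = c₆/216`),
`W ~_ℚ W' ↔ ∃ a ∈ ℤ ∖ {0}, aΛ ⊆ Λ'`: `⇒` is the tree's discharged fact
`neronLattice_commensurable_of_isIsogenous_holds` (`EichlerShimuraConstructionLatticeProofs`),
`⇐` is `isIsogenous_of_forall_mul_mem_lattice` (`AnalyticIsogenyDescentProofs`).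
[cite: SilvermanAEC2009, Thm. VI.4.1, Thm. VI.5.3] -/
theorem isIsogenous_iff_exists_int_mul_mem_lattice {W W' : WeierstrassCurve ℚ} [W.IsElliptic]
    [W'.IsElliptic] {L L' : PeriodPair} (hL : IsNeronLatticeOf (W.baseChange ℂ) L)
    (hL' : IsNeronLatticeOf (W'.baseChange ℂ) L') :
    WeierstrassCurve.IsIsogenous W W' ↔ ∃ a : ℤ, a ≠ 0 ∧ ∀ z ∈ L.lattice, (a : ℂ) * z ∈ L'.lattice :=
  ⟨fun hiso ↦ neronLattice_commensurable_of_isIsogenous_holds hiso hL hL',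
    fun ⟨a, ha, hle⟩ ↦ isIsogenous_of_forall_mul_mem_lattice hL.1 hL.2 hL'.1 hL'.2
      (c := (a : ℚ)) (by exact_mod_cast ha) (fun z hz ↦ by rw [Rat.cast_intCast]; exact hle z hz)⟩

/-! ### The Eichler–Shimura construction with its lattice, from any parametrised curve -/

/-- **`hES` from a parametrised curve.** If some elliptic curve over `ℚ` admits a modular
parametrisation datum at level `N` with newform `f`, then the strong Weil curve of `f` exists
over `ℚ` in the strong sense of `hES`: an elliptic `W₀/ℚ` with `aₙ(W₀) = aₙ(f)` for all `n` and
a Néron-type period pair spanning exactly `Λ_f` (`ModularParametrizationData.exists_latticeEq_model`).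
In particular the tree's named fact `eichlerShimuraConstruction` holds at `f`
(`eichlerShimuraConstruction_of_latticeEq` pattern: `1 · Λ_f ⊆ Λ_{E₀}` for every Néron-type
period pair of `W₀`, all of which span the same lattice, `IsNeronLatticeOf.lattice_eq`).
[cite: Knapp1993, Thm. 11.74 (d), (e) with Remarks (PDF p. 287) and Thm. 12.8 (PDF p. 301)] -/
theorem exists_isNewformOf_latticeEq_of_nonempty_modularParametrizationData
    {W : WeierstrassCurve ℚ} [W.IsElliptic] {N : ℕ} [NeZero N] {f : CuspForm (Gamma0 N) 2}
    (h : ∃ D : ModularParametrizationData W N, D.f = f) :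
    ∃ (W₀ : WeierstrassCurve ℚ) (_ : W₀.IsElliptic), IsNewformOf W₀ f ∧
      (∀ {L : PeriodPair}, IsNeronLatticeOf (W₀.baseChange ℂ) L →
        ∀ z ∈ periodLattice f, ((1 : ℤ) : ℂ) * z ∈ L.lattice) ∧
      ∃ L₀ : PeriodPair, IsNeronLatticeOf (W₀.baseChange ℂ) L₀ ∧
        (L₀.lattice : Set ℂ) = periodLattice f := by
  obtain ⟨D, rfl⟩ := h
  obtain ⟨W₀, hW₀, hf₀, L₀, hL₀, hΛ⟩ := D.exists_latticeEq_model
  refine ⟨W₀, hW₀, hf₀, fun {L} hL z hz ↦ ?_, L₀, hL₀, hΛ⟩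
  rw [Int.cast_one, one_mul, ← IsNeronLatticeOf.lattice_eq hL₀ hL, ← SetLike.mem_coe, hΛ]
  exact hz

end Literature.NumberTheory.EllipticCurves.ModularForms

end
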